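import Summits.BirchSwinnertonDyer.BirchSwinnertonDyer.Theorems.SignedLowerHalvesSmallImageLowerHalfBothSignsRttJunctionShaSocket
import Literature.NumberTheory.ComplexMultiplication.EllipticUnits.ImaginaryQuadraticMainConjectureClassGroupRowGlue
import HarnessLib

/-!
# Route `SignedLowerHalves`, crux L `SmallImageLowerHalfBothSigns` (stmt-BirchSwinnertonDyer-23599), line `rtt_w3` v35 — stub S3α″ (`stub_junctionShaPi_ns`),
# brick α5′-5: THE GLUING — `hglue` of the Poitou–Tate socket from the KERNEL PROPERTY of the comparison maps `ι_{n,k}`, and the range of `π` modulo that property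

INPUTS hand `bsd-inputs-honda-p1` g29 under LEAD `cruxlead-stmt-BirchSwinnertonDyer-23599` (cell `bsd-ssimc`); helper `--supports stmt-BirchSwinnertonDyer-23599`.
DEFINITIONS WITH BODIES (`resYOIter`, `inclYOIter`) + THEOREMS; no named fact, no instance, no `sorry`. The one-variable twin of §5–§6 of the tree's
`Literature/…/EllipticUnits/ImaginaryQuadraticMainConjectureClassGroupRowGlue.lean`: the abstract Baer/`ℚ/ℤ`-injectivity step is the tree's
`JohnsonLeungKings2011.LayerGlue.exists_character`; what is specific to a system of comparison maps `ι n k : Ш¹_P(K_n, A[p^k]) → U` is the KERNEL PROPERTY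
«`ι_{n,k} z = 0 ⟹ z` dies after finitely many inclusion and restriction steps» (hypothesis `hK`), from which the compatible character families kill the kernels.
* §1 the iterated transition maps `resYOIter n k a : Y_{n,k} → Y_{n+a,k}`, `inclYOIter n k b : Y_{n,k} → Y_{n,k+b}` and the values of compatible families on them;
* §2 the KERNEL PROPERTY `hK` of `ι` («`ι_{n,k} z = 0 ⟹ z` dies after finitely many inclusion and restriction steps», an inline hypothesis), ★ `exists_character_of_kernelProperty` (= `hglue`);
* §3 ★★ `piLinear_mem_range_iff_of_kernelProperty` — `b ∈ range π ↔ ∀ n k, I.proj n k b ∈ Ш²_P(K_n, X_k)` for every system `ι` with the kernel property.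
The sequel bricks construct `ι` into lambda-p1's `strictSelmer` and prove its kernel property (cocycle argument: the coboundary witness lies in `A[p^{k'}]`, then Serre I §2.2
Prop. 8 along the tower), and plug `A := Cofree θ F`.
HONEST FRAMING: algebraic assembly; α5′, S3α″, crux L and BSD are NOT proved here and remain OPEN; BSD is proved for NO curve.
References: [JohnsonLeungKings2011] §5.4 Lemma 5.8 and its proof (arXiv p0015:L150–p0016:L20); [MilneADT2006] I §0, I Thm. 4.10 (a); [SerreGaloisCohomology1997] I §2.2 Prop. 8.
-/

set_option autoImplicit false
set_option linter.dupNamespace false -- D-0017: single-problem summit, the namespace repeats the problem name by design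
noncomputable section

open scoped Classical
open NumberField IsDedekindDomain Field Function CategoryTheory PowerSeries

namespace Summit.BirchSwinnertonDyer.BirchSwinnertonDyer.Theorems.SmallImageRttJunctionSha

open Literature.NumberTheory.EllipticCurves Literature.NumberTheory.EllipticCurves.IwasawaDual Literature.NumberTheory.GaloisRepresentations
  Literature.NumberTheory.GaloisRepresentations.DiscreteGaloisModule Literature.NumberTheory.GaloisCohomology Literature.NumberTheory.GaloisCohomology.ShaLayer
  Literature.NumberTheory.ComplexMultiplication.EllipticUnits Literature.NumberTheory.ComplexMultiplication.EllipticUnits.JohnsonLeungKings2011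
  Summit.BirchSwinnertonDyer.BirchSwinnertonDyer.Theorems.SmallImageRttD2J1 Summit.BirchSwinnertonDyer.BirchSwinnertonDyer.Theorems.SmallImageRttD2Seq

/-! ## §1 Iterated transition maps of the system `Y_{n,k} = Ш¹_P(K_n, A[p^k])` -/

section Iter

variable {K : Type} [Field K] [NumberField K] {p : ℕ} [Fact p.Prime] (κ : ZpExtension K p) (P : Set (HeightOneSpectrum (𝓞 K)))
  (M : Type) [AddCommGroup M] [DistribMulAction (absoluteGaloisGroup K) M] [TopologicalSpace M] [DiscreteTopology M]
  (hstab : ∀ m : M, IsOpen (MulAction.stabilizer (absoluteGaloisGroup K) m : Set (absoluteGaloisGroup K)))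
  (hNP : ∀ n : ℕ, ramificationSubgroup K P ≤ κ.layerSubgroup n) (hA : ∀ k : ℕ, ramificationSubgroup K P ≤ ContinuousRep.ker (torsRep M hstab p k))

/-- `a` restriction steps `Ш¹_P(K_n, A[p^k]) → Ш¹_P(K_{n+a}, A[p^k])`. [cite: SerreGaloisCohomology1997, I §2.5] -/
def resYOIter (n k : ℕ) : ∀ a : ℕ,
    ↥(layerShaRestricted P (torsRep M hstab p k) (κ.layerSubgroup n) 1) →+ ↥(layerShaRestricted P (torsRep M hstab p k) (κ.layerSubgroup (n + a)) 1)
  | 0 => AddMonoidHom.id _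
  | a + 1 => (resYO κ P M hstab hNP hA (n + a) k).comp (resYOIter n k a)

/-- `b` inclusion steps `Ш¹_P(K_n, A[p^k]) → Ш¹_P(K_n, A[p^{k+b}])`. [cite: MilneADT2006, I §4 (p. 56)] -/
def inclYOIter (n k : ℕ) : ∀ b : ℕ,
    ↥(layerShaRestricted P (torsRep M hstab p k) (κ.layerSubgroup n) 1) →+ ↥(layerShaRestricted P (torsRep M hstab p (k + b)) (κ.layerSubgroup n) 1)
  | 0 => AddMonoidHom.id _
  | b + 1 => (inclYO κ P M hstab hNP hA n (k + b)).comp (inclYOIter n k b)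

/-- `resYOIter n k 0 = id`. [folklore] -/
theorem resYOIter_zero (n k : ℕ) (z : ↥(layerShaRestricted P (torsRep M hstab p k) (κ.layerSubgroup n) 1)) : resYOIter κ P M hstab hNP hA n k 0 z = z := rfl

/-- `resYOIter n k (a+1) = resYO ∘ resYOIter n k a`. [folklore] -/
theorem resYOIter_succ (n k a : ℕ) (z : ↥(layerShaRestricted P (torsRep M hstab p k) (κ.layerSubgroup n) 1)) :
    resYOIter κ P M hstab hNP hA n k (a + 1) z = resYO κ P M hstab hNP hA (n + a) k (resYOIter κ P M hstab hNP hA n k a z) := rfl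

/-- `inclYOIter n k 0 = id`. [folklore] -/
theorem inclYOIter_zero (n k : ℕ) (z : ↥(layerShaRestricted P (torsRep M hstab p k) (κ.layerSubgroup n) 1)) : inclYOIter κ P M hstab hNP hA n k 0 z = z := rfl

/-- `inclYOIter n k (b+1) = inclYO ∘ inclYOIter n k b`. [folklore] -/
theorem inclYOIter_succ (n k b : ℕ) (z : ↥(layerShaRestricted P (torsRep M hstab p k) (κ.layerSubgroup n) 1)) :
    inclYOIter κ P M hstab hNP hA n k (b + 1) z = inclYO κ P M hstab hNP hA n (k + b) (inclYOIter κ P M hstab hNP hA n k b z) := rfl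

variable {X : Type*} (χ : ∀ n k : ℕ, ↥(layerShaRestricted P (torsRep M hstab p k) (κ.layerSubgroup n) 1) → X)

/-- A `res`-compatible family takes the same value along the iterated restrictions. [folklore] -/
theorem apply_resYOIter (hχres : ∀ (n k : ℕ) (z), χ (n + 1) k (resYO κ P M hstab hNP hA n k z) = χ n k z) (n k a : ℕ)
    (z : ↥(layerShaRestricted P (torsRep M hstab p k) (κ.layerSubgroup n) 1)) : χ (n + a) k (resYOIter κ P M hstab hNP hA n k a z) = χ n k z := by
  induction a with
  | zero => rfl
  | succ a ih => exact (hχres (n + a) k _).trans ih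

/-- An `incl`-compatible family takes the same value along the iterated inclusions. [folklore] -/
theorem apply_inclYOIter (hχincl : ∀ (n k : ℕ) (z), χ n (k + 1) (inclYO κ P M hstab hNP hA n k z) = χ n k z) (n k b : ℕ)
    (z : ↥(layerShaRestricted P (torsRep M hstab p k) (κ.layerSubgroup n) 1)) : χ n (k + b) (inclYOIter κ P M hstab hNP hA n k b z) = χ n k z := by
  induction b with
  | zero => rfl
  | succ b ih => exact (hχincl n (k + b) _).trans ih

end Iter

/-! ## §2 The kernel property of a system of comparison maps and the gluing `hglue` -/

section Kernel

variable {K : Type} [Field K] [NumberField K] {p : ℕ} [Fact p.Prime] (κ : ZpExtension K p) (P : Set (HeightOneSpectrum (𝓞 K)))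
  (M : Type) [AddCommGroup M] [DistribMulAction (absoluteGaloisGroup K) M] [TopologicalSpace M] [DiscreteTopology M]
  (hstab : ∀ m : M, IsOpen (MulAction.stabilizer (absoluteGaloisGroup K) m : Set (absoluteGaloisGroup K)))
  (hNP : ∀ n : ℕ, ramificationSubgroup K P ≤ κ.layerSubgroup n) (hA : ∀ k : ℕ, ramificationSubgroup K P ≤ ContinuousRep.ker (torsRep M hstab p k))
  (U : Type) [AddCommGroup U] (ι : ∀ n k : ℕ, ↥(layerShaRestricted P (torsRep M hstab p k) (κ.layerSubgroup n) 1) →+ U)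

variable {κ P M hstab hNP hA U ι}

/-- ★ **GLUING (`hglue` of the socket) from the kernel property `hK`** («`ι_{n,k} z = 0 ⟹ z` dies after `b` inclusion and `a` restriction steps»; for `U = H¹(K_∞, A)`
it HOLDS: the coboundary witness lies in some `A[p^{k'}]`, and a class dying on `Gal(K̄/K_∞)` dies on some `Gal(K̄/K_{n'})`, Serre I §2.2 Prop. 8 — the sequel brick): every family of characters `χ_{n,k}` of the `Ш¹_P(K_n, A[p^k])` compatible with restriction and inclusion
is `y ∘ ι_{n,k}` for ONE character `y` of `U` (`χ` kills `ker ι_{n,k}` by the kernel property and compatibility; then the tree's abstract `LayerGlue.exists_character`: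
directed union of the images + injectivity of `ℚ/ℤ`). [cite: JohnsonLeungKings2011, §5.4 Lemma 5.8 (proof, arXiv p0015:L150–p0016:L20)] [cite: MilneADT2006, I §0] -/
theorem exists_character_of_kernelProperty
    (hK : ∀ (n k : ℕ) (z : ↥(layerShaRestricted P (torsRep M hstab p k) (κ.layerSubgroup n) 1)), ι n k z = 0 →
      ∃ b a : ℕ, resYOIter κ P M hstab hNP hA n (k + b) a (inclYOIter κ P M hstab hNP hA n k b z) = 0)
    (hιres : ∀ (n k : ℕ) (z), ι (n + 1) k (resYO κ P M hstab hNP hA n k z) = ι n k z)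
    (hιincl : ∀ (n k : ℕ) (z), ι n (k + 1) (inclYO κ P M hstab hNP hA n k z) = ι n k z)
    (χ : ∀ n k : ℕ, ↥(layerShaRestricted P (torsRep M hstab p k) (κ.layerSubgroup n) 1) →+ AddCircle (1 : ℚ))
    (hχres : ∀ (n k : ℕ) (z), χ (n + 1) k (resYO κ P M hstab hNP hA n k z) = χ n k z)
    (hχincl : ∀ (n k : ℕ) (z), χ n (k + 1) (inclYO κ P M hstab hNP hA n k z) = χ n k z) :
    ∃ y : U →+ AddCircle (1 : ℚ), ∀ (n k : ℕ) (z), y (ι n k z) = χ n k z :=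
  LayerGlue.exists_character (Y := fun n k ↦ ↥(layerShaRestricted P (torsRep M hstab p k) (κ.layerSubgroup n) 1)) ι (resYO κ P M hstab hNP hA)
    (inclYO κ P M hstab hNP hA) χ hιres hιincl hχres hχincl fun n k z hz ↦ by
      obtain ⟨b, a, h0⟩ := hK n k z hz
      rw [← apply_inclYOIter κ P M hstab hNP hA (fun n k ↦ ⇑(χ n k)) hχincl n k b z,
        ← apply_resYOIter κ P M hstab hNP hA (fun n k ↦ ⇑(χ n k)) hχres n (k + b) a, h0, map_zero]

end Kernel

/-! ## §3 The range of `π` modulo the kernel property -/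

section Range

variable {K : Type} [Field K] [NumberField K] {p : ℕ} [Fact p.Prime] (S : Set (PadicAlgCl p)) [FiniteDimensional ℚ_[p] (padicCoeffField S)]
  (κ : ZpExtension K p) (γ : absoluteGaloisGroup K) (θ' : absoluteGaloisGroup K →ₜ* (padicCoeffIntegers S)ˣ) (P : Set (HeightOneSpectrum (𝓞 K)))
  (M : Type) [AddCommGroup M] [DistribMulAction (absoluteGaloisGroup K) M] [TopologicalSpace M] [DiscreteTopology M]
  (hstab : ∀ m : M, IsOpen (MulAction.stabilizer (absoluteGaloisGroup K) m : Set (absoluteGaloisGroup K)))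
  (B : ∀ k : ℕ, OMuCarrier K S (p ^ k) →+ ↥(torsionPow M p k) →+ MuCarrier K (p ^ k))
  (hB : ∀ (k : ℕ) (σ : absoluteGaloisGroup K) (x : OMuCarrier K S (p ^ k)) (m : ↥(torsionPow M p k)),
    B k (muTwistO S θ' k σ x) (torsRep M hstab p k σ m) = mu K (p ^ k) σ (B k x m))
  (hPT : poitouTate_shaRestricted_tateDual_natural_at K P)
  [hFin : ∀ n : ℕ, Fintype (absoluteGaloisGroup K ⧸ κ.layerSubgroup n)]
  (hNP : ∀ n : ℕ, ramificationSubgroup K P ≤ κ.layerSubgroup n)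
  (hμ : ∀ k : ℕ, ramificationSubgroup K P ≤ ContinuousRep.ker (muTwistO S θ' k))
  (hA : ∀ k : ℕ, ramificationSubgroup K P ≤ ContinuousRep.ker (torsRep M hstab p k))
  (hpP : ∀ v : HeightOneSpectrum (𝓞 K), ((p : ℕ) : 𝓞 K) ∈ v.asIdeal → v ∈ P)
  (hperf : ∀ k : ℕ, Bijective fun m : ↥(torsionPow M p k) ↦ (B k).flip m)
  (U : Type) [AddCommGroup U] (ι : ∀ n k : ℕ, ↥(layerShaRestricted P (torsRep M hstab p k) (κ.layerSubgroup n) 1) →+ U)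
  (hιres : ∀ (n k : ℕ) (z : layerShaRestricted P (torsRep M hstab p k) (κ.layerSubgroup n) 1), ι (n + 1) k (resYO κ P M hstab hNP hA n k z) = ι n k z)
  (hιincl : ∀ (n k : ℕ) (z : layerShaRestricted P (torsRep M hstab p k) (κ.layerSubgroup n) 1), ι n (k + 1) (inclYO κ P M hstab hNP hA n k z) = ι n k z)
  (hBred : ∀ (k : ℕ) (x : OMuCarrier K S (p ^ (k + 1))) (m : ↥(torsionPow M p k)),
      muVal K (p ^ k) (B k (oMuRed S k x) m) = muVal K (p ^ (k + 1)) (B (k + 1) x (AddSubgroup.inclusion (torsionPow_mono (M := M) (p := p) (Nat.le_succ k)) m)))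
  (I : CycIwasawaCohomologyDataO S κ γ θ' P 2)
  (cU : AddMonoid.End U) (hU : IsLocNil p (cU - 1))
  (hιc : ∀ (n k : ℕ) (z : layerShaRestricted P (torsRep M hstab p k) (κ.layerSubgroup n) 1), ι n k (conjYO κ P M hstab n k γ⁻¹ z) = cU (ι n k z))

/-- ★★ **THE RANGE OF THE POITOU–TATE MAP `π`, modulo the kernel property of `ι`**: for a system of comparison maps `ι_{n,k} : Ш¹_P(K_n, A[p^k]) → U` compatible with
restriction, inclusion and conjugation and with the kernel property, `b ∈ range π ↔` every level projection `I.proj n k b` lies in `Ш²_P(K_n, X_k)` — JLK's Lemma 5.8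
«`coker(Ш¹_P(K_∞, A)^∨ → 𝐇²_{Iw,P}) ↪ ⊕_{w ∈ P} H²_Iw(K_w, T*)`» in honda's one-variable currency. [cite: JohnsonLeungKings2011, §5.4 Lemma 5.8 (arXiv p0015:L150–p0016:L20)]
[cite: MilneADT2006, I Thm. 4.10 (a)] [cite: NeukirchSchmidtWingberg2008, (8.6.10)] -/
theorem piLinear_mem_range_iff_of_kernelProperty
    (hK : ∀ (n k : ℕ) (z : ↥(layerShaRestricted P (torsRep M hstab p k) (κ.layerSubgroup n) 1)), ι n k z = 0 →
      ∃ b a : ℕ, resYOIter κ P M hstab hNP hA n (k + b) a (inclYOIter κ P M hstab hNP hA n k b z) = 0) (b : I.H) :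
    letI := hU.module (A := AddCircle (1 : ℚ)); letI := I.moduleIwasawa
    b ∈ LinearMap.range (piLinear S κ γ θ' P M hstab B hB hPT hNP hμ hA hpP hperf U ι hιres hιincl hBred I cU hU hιc) ↔
      ∀ n k : ℕ, I.proj n k b ∈ layerShaRestricted P (muTwistO S θ' k) (κ.layerSubgroup n) 2 :=
  piLinear_mem_range_iff_of_glue S κ γ θ' P M hstab B hB hPT hNP hμ hA hpP hperf U ι hιres hιincl hBred I cU hU hιc
    (fun χ hχres hχincl ↦ exists_character_of_kernelProperty hK hιres hιincl χ hχres hχincl) b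

end Range

end Summit.BirchSwinnertonDyer.BirchSwinnertonDyer.Theorems.SmallImageRttJunctionSha

end
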